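import Mathlib
import Literature.NumberTheory.LFunctions.Zhang2022.Section7Step7u033Repaired
import HarnessLib

/-!
# Zhang (2022), §7 (7.14) / §14 (14.8): the per-term Mellin bound for ARBITRARY prime-sum coefficients, kernel-checked

Topic `Literature/NumberTheory/LFunctions/Zhang2022` (Landau–Siegel audit tree; verdict-neutral).
Y. Zhang, *Discrete mean estimates and the Landau–Siegel zero*, arXiv:2211.02515v1 (2022)
[Zhang2022LandauSiegel] — **an unrefereed manuscript under adjudication** (cell `siegel-zhang`, D-0069).
DAG nodes `Z22:(7.14)`/`Z22:§7.u033` [Z22 p.38, tex L2009–2019] and `Z22:(14.8)` with its two `r`-ranges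
[Z22 p.82, tex L3945–3966: "for `1 < r < D³` we use the Mellin transform, Lemma 5.4 (i) and Lemma 5.6; for
`D³ ≤ r < 2DP₄` we use the Mellin transform, Lemma 5.4 (i) and the large sieve inequality"] — GAP-LEDGER
G-adj2-2 (proved) / G-adj2-4. The REPAIRED route replaces Lemma 5.4 (i)'s weight `𝓛ᶜ/(1+t²)` by the exact
`|δ(1+it)|` and splits at `|t| = D/2`. This file packages that route ONCE for arbitrary coefficients
`a : ℕ → ℂ`, so that every consumer ((7.14) with `a(p) = p^{β₃}θ̄(p)`: `Skeleton.step7u033_repaired`;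
(14.8) with `a(p) = χθ̄(p)`; the large-sieve legs) only has to supply the two prime-sum inputs:

* `Skeleton.norm_sum_primeWindow_mul_DeltaW_le_of_bounds` — **for every `A : ℕ` there is `C` such that
  for all large `D`, for all `a`, `c₀ > 0`, `E, F ≥ 0` with `‖Σ_{p∼P} a(p)p^{1+it}‖ ≤ E` for `|t| ≤ D/2`
  and `≤ F` for all `t`: `‖Σ_{p∼P} a(p)Δ(c₀/p)‖ ≤ C·c₀⁻¹·(E·𝓛⁵¹⁹⁰ + F·D^{−A})`** — the `|t| ≤ D/2` part
  against `∫_ℝ‖δ(1+it)‖ ≪ 𝓛⁵¹⁹⁰` (Lemma 5.4 (i), `Skeleton.integral_norm_deltaW_line_le`), the `|t| > D/2`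
  part against the rapid-decay tail `Skeleton.deltaW_tail_integral_le` with all `𝓛`-powers absorbed
  (`Skeleton.exists_mul_ell_pow_le`);
* `Skeleton.ell_pow_5190_mul_exp_neg_le` — `𝓛⁵¹⁹⁰·e^{−𝓛^{9/2}} ≤ 2595!·D^{−A}` once `𝓛 ≥ A + 1`: turns a
  Lemma-5.6 input `E = C′𝔓e^{−𝓛^{9/2}}` into `E·𝓛⁵¹⁹⁰ ≤ C′·2595!·𝔓·D^{−A}`.

NOT here: the Lemma-5.6 / large-sieve inputs themselves, or any claim about Prop. 7.1 / 14.1, Theorems 1–2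
or Landau–Siegel zeros.

## References

* Y. Zhang, arXiv:2211.02515v1 (2022), §7 (7.14) p.38; §14 (14.8) p.82; §5 Lemma 5.4 (i) p.28.
  [cite: Zhang2022LandauSiegel, §7 (7.14); §14 (14.8)]
-/

noncomputable section

open Complex Real Set MeasureTheory Filter Topology

namespace Literature.NumberTheory.LFunctions.Zhang2022.Skeleton

/-- `𝓛 = log D ≥ 1` for `D ≥ 3`. [folklore] -/
private theorem one_le_ell_of_three_le {D : ℕ} (hD : 3 ≤ D) : 1 ≤ ell D := by
  rw [ell, Real.le_log_iff_exp_le (by exact_mod_cast (show 0 < D by omega))]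
  have h3 : (3 : ℝ) ≤ D := by exact_mod_cast hD
  linarith [Real.exp_one_lt_d9]

/-- `∫_ℝ‖δ(1+it)‖ ≤ K·𝓛⁵¹⁹⁰` (`D ≥ 3`) with one fixed `K ≥ 0` (`Skeleton.integral_norm_deltaW_line_le`).
[cite: Zhang2022LandauSiegel, §5 Lemma 5.4 (i)] -/
private theorem exists_K_integral_norm_deltaW_line_le :
    ∃ K : ℝ, 0 ≤ K ∧ ∀ D : ℕ, 3 ≤ D → ∫ t : ℝ, ‖deltaW D (1 + t * I)‖ ≤ K * ell D ^ 5190 := by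
  have hJ0 : 0 ≤ Lemma53.Jconst 1 2 := Lemma53.Jconst_nonneg' 1 2
  refine ⟨(2 * Lemma53.Jconst 1 2 + 4 * ((2 + Real.exp 1) * (4 * π) ^ 2
      * Real.exp (((5 : ℕ) : ℝ) ^ 2) + (Real.exp 1 * ((2 * 5).factorial : ℝ) + 5 ^ 5)
      * Lemma53.Jconst 1 2)) * π, by positivity, fun D hD => ?_⟩
  have := integral_norm_deltaW_line_le hD
  linarith

/-- **`𝓛⁵¹⁹⁰·e^{−𝓛^{9/2}} ≤ 2595!·D^{−A}` once `𝓛 ≥ A + 1`** (`𝓛^{9/2} ≥ 𝓛³ ≥ 𝓛² + A𝓛`,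
`𝓛⁵¹⁹⁰ ≤ 2595!·e^{𝓛²}`, `e^{−A𝓛} = D^{−A}`): converts a Lemma-5.6 size `𝔓e^{−𝓛^{9/2}}` times the
Lemma-5.4 (i) size `𝓛⁵¹⁹⁰` into a power saving. [folklore] [cite: Zhang2022LandauSiegel, §5 Lemma 5.6] -/
theorem ell_pow_5190_mul_exp_neg_le {D : ℕ} (hD : 3 ≤ D) (A : ℕ) (hℓA : (A : ℝ) + 1 ≤ ell D) :
    ell D ^ 5190 * Real.exp (-(ell D ^ ((9 : ℝ) / 2)))
      ≤ (Nat.factorial 2595 : ℝ) * (D : ℝ) ^ (-(A : ℝ)) := by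
  have hℓ1 : 1 ≤ ell D := one_le_ell_of_three_le hD
  have hℓ0 : 0 < ell D := by linarith
  have hD0 : (0 : ℝ) < D := by exact_mod_cast (show 0 < D by omega)
  have h45 : ell D ^ 3 ≤ ell D ^ ((9 : ℝ) / 2) := by
    have := Real.rpow_le_rpow_of_exponent_le hℓ1 (show ((3 : ℕ) : ℝ) ≤ (9 : ℝ) / 2 by norm_num)
    rwa [Real.rpow_natCast] at this
  have h3 : ell D ^ 2 + A * ell D ≤ ell D ^ 3 := by
    have hA : (A : ℝ) ≤ ell D - 1 := by linarith
    have h4 : (A : ℝ) * ell D ≤ (ell D - 1) * ell D := mul_le_mul_of_nonneg_right hA hℓ0.le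
    nlinarith [mul_nonneg hℓ0.le (sq_nonneg (ell D - 1))]
  have h5190 : ell D ^ 5190 ≤ (Nat.factorial 2595 : ℝ) * Real.exp (ell D ^ 2) := by
    have := Real.pow_div_factorial_le_exp (ell D ^ 2) (by positivity) 2595
    rw [div_le_iff₀ (by positivity), ← pow_mul, show 2 * 2595 = 5190 by norm_num] at this
    linarith
  have hDA : (D : ℝ) ^ (-(A : ℝ)) = Real.exp (-(A * ell D)) := by
    rw [Real.rpow_def_of_pos hD0, ell]; congr 1; ring
  rw [hDA]
  calc ell D ^ 5190 * Real.exp (-(ell D ^ ((9 : ℝ) / 2)))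
      ≤ ((Nat.factorial 2595 : ℝ) * Real.exp (ell D ^ 2)) * Real.exp (-(ell D ^ 2 + A * ell D)) := by
        refine mul_le_mul h5190 (Real.exp_le_exp.mpr (by linarith)) (Real.exp_nonneg _) (by positivity)
    _ = (Nat.factorial 2595 : ℝ) * Real.exp (-(A * ell D)) := by
        rw [mul_assoc, ← Real.exp_add]; congr 2; ring

/-- **The per-term Mellin bound for arbitrary coefficients** (the REPAIRED route of (7.14)/§7.u033 and
of the two (14.8) legs, packaged once): for every `A : ℕ` there is `C` such that, for all sufficiently
large `D` (and every real primitive `χ mod D`, vacuously), for every `a : ℕ → ℂ`, `c₀ > 0`, `E ≥ 0`,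
`F ≥ 0` with `‖Σ_{p∼P} a(p)p^{1+it}‖ ≤ E` whenever `|t| ≤ D/2` and `‖Σ_{p∼P} a(p)p^{1+it}‖ ≤ F` for all
`t`: `‖Σ_{p∼P} a(p)Δ(c₀/p)‖ ≤ C·c₀⁻¹·(E·𝓛⁵¹⁹⁰ + F·D^{−A})` (`Δ = Skeleton.DeltaW D`). Unconditional (no (A)).
[cite: Zhang2022LandauSiegel, §7 (7.14); §14 (14.8)] -/
theorem norm_sum_primeWindow_mul_DeltaW_le_of_bounds (A : ℕ) :
    ∃ C : ℝ, ForAllLarge fun D _ _ => ∀ (a : ℕ → ℂ) (c₀ E F : ℝ), 0 < c₀ → 0 ≤ E → 0 ≤ F →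
      (∀ t : ℝ, |t| ≤ (D : ℝ) / 2 →
        ‖∑ p ∈ primeWindow D, a p * (p : ℂ) ^ (1 + (t : ℂ) * I)‖ ≤ E) →
      (∀ t : ℝ, ‖∑ p ∈ primeWindow D, a p * (p : ℂ) ^ (1 + (t : ℂ) * I)‖ ≤ F) →
        ‖∑ p ∈ primeWindow D, a p * DeltaW D (c₀ / p)‖
          ≤ C * c₀⁻¹ * (E * ell D ^ 5190 + F * (D : ℝ) ^ (-(A : ℝ))) := by
  obtain ⟨cT, CT, hT⟩ := deltaW_tail_integral_le (A + 1)
  obtain ⟨K, hK0, hK⟩ := exists_K_integral_norm_deltaW_line_le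
  obtain ⟨D₀, hall⟩ :=
    (hT.and (norm_sum_primeWindow_mul_DeltaW_le.and integrable_norm_deltaW_mul_norm_primeSum)).and
      integrable_deltaW_line
  obtain ⟨D₁, hD₁⟩ := exists_mul_ell_pow_le 535 (show (0 : ℝ) ≤ 2 by norm_num)
  obtain ⟨D₂, hD₂⟩ := exists_mul_ell_pow_le (⌈cT⌉₊ + 535 * (A + 1 + 2))
    (show (0 : ℝ) ≤ 2 ^ (A + 1) by positivity)
  refine ⟨(1 / (2 * π)) * (K + |CT|), D₀ + D₁ + D₂ + 3,
    fun D _ χ hD hq hp a c₀ E F hc₀ hE hF hEb hFb => ?_⟩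
  obtain ⟨⟨hTD, ⟨h714, hint⟩⟩, hδint⟩ := hall D χ (by omega) hq hp
  have hD3 : 3 ≤ D := by omega
  have hℓ1 : 1 ≤ ell D := one_le_ell_of_three_le hD3
  have hℓ0 : 0 < ell D := by linarith
  have hD0 : (0 : ℝ) < D := by exact_mod_cast (show 0 < D by omega)
  -- `T₀ = t₀^{1.03} ≤ 𝓛⁵³⁵`, `X = D/2 ≥ T₀`
  have ht00 : 0 ≤ t0 D := pow_nonneg hℓ0.le _
  have hT535 : t0 D ^ (1.03 : ℝ) ≤ ell D ^ 535 := by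
    rw [t0, ← Real.rpow_natCast (ell D) 519, ← Real.rpow_mul hℓ0.le, ← Real.rpow_natCast (ell D) 535]
    exact Real.rpow_le_rpow_of_exponent_le hℓ1 (by norm_num)
  have hT0nn : 0 ≤ t0 D ^ (1.03 : ℝ) := Real.rpow_nonneg ht00 _
  have hX : t0 D ^ (1.03 : ℝ) ≤ (D : ℝ) / 2 := by
    have := hD₁ D (by omega); linarith
  have hX0 : 0 < (D : ℝ) / 2 := by positivity
  obtain ⟨hSint, hStail⟩ := hTD ((D : ℝ) / 2) hX
  -- the exact-weight inequality
  have h1 := h714 a c₀ hc₀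
  have hfi := hint a
  set f : ℝ → ℝ := fun t => ‖deltaW D (1 + t * I)‖ *
    ‖∑ p ∈ primeWindow D, a p * (p : ℂ) ^ (1 + (t : ℂ) * I)‖ with hf
  set S : Set ℝ := {t : ℝ | (D : ℝ) / 2 ≤ |t|} with hS
  have hSm : MeasurableSet S := (isClosed_le continuous_const continuous_abs).measurableSet
  -- the tail part `|t| ≥ D/2`
  have hfS : ∫ t in S, f t ≤ F * (|CT| * ell D ^ cT * (t0 D ^ (1.03 : ℝ)) ^ (A + 1 + 2) *
      ((D : ℝ) / 2) ^ (-((A + 1 : ℕ) : ℝ))) := by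
    have hg : IntegrableOn (fun t : ℝ => F * ‖deltaW D (1 + t * I)‖) S := hSint.norm.const_mul _
    calc ∫ t in S, f t ≤ ∫ t in S, F * ‖deltaW D (1 + t * I)‖ := by
          refine setIntegral_mono_on hfi.integrableOn hg hSm fun t _ => ?_
          simp only [hf]
          rw [mul_comm F]
          exact mul_le_mul_of_nonneg_left (hFb t) (norm_nonneg _)
      _ = F * ∫ t in S, ‖deltaW D (1 + t * I)‖ := integral_const_mul _ _
      _ ≤ F * (|CT| * ell D ^ cT * (t0 D ^ (1.03 : ℝ)) ^ (A + 1 + 2) *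
          ((D : ℝ) / 2) ^ (-((A + 1 : ℕ) : ℝ))) := by
          refine mul_le_mul_of_nonneg_left (hStail.trans ?_) hF
          have : 0 ≤ ell D ^ cT * (t0 D ^ (1.03 : ℝ)) ^ (A + 1 + 2) * ((D : ℝ) / 2) ^ (-((A + 1 : ℕ) : ℝ)) :=
            mul_nonneg (mul_nonneg (Real.rpow_nonneg hℓ0.le _) (pow_nonneg hT0nn _))
              (Real.rpow_nonneg hX0.le _)
          calc CT * ell D ^ cT * (t0 D ^ (1.03 : ℝ)) ^ (A + 1 + 2) * ((D : ℝ) / 2) ^ (-((A + 1 : ℕ) : ℝ))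
              = CT * (ell D ^ cT * (t0 D ^ (1.03 : ℝ)) ^ (A + 1 + 2) *
                  ((D : ℝ) / 2) ^ (-((A + 1 : ℕ) : ℝ))) := by ring
            _ ≤ |CT| * (ell D ^ cT * (t0 D ^ (1.03 : ℝ)) ^ (A + 1 + 2) *
                  ((D : ℝ) / 2) ^ (-((A + 1 : ℕ) : ℝ))) :=
                mul_le_mul_of_nonneg_right (le_abs_self _) this
            _ = _ := by ring
  -- the central part `|t| < D/2`
  have hfSc : ∫ t in Sᶜ, f t ≤ E * (K * ell D ^ 5190) := by
    have hg : IntegrableOn (fun t : ℝ => E * ‖deltaW D (1 + t * I)‖) Sᶜ :=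
      (hδint.norm.const_mul E).integrableOn
    calc ∫ t in Sᶜ, f t ≤ ∫ t in Sᶜ, E * ‖deltaW D (1 + t * I)‖ := by
          refine setIntegral_mono_on hfi.integrableOn hg hSm.compl fun t ht => ?_
          have ht' : |t| ≤ (D : ℝ) / 2 := by
            rw [Set.mem_compl_iff, hS, Set.mem_setOf_eq, not_le] at ht; exact ht.le
          simp only [hf]
          rw [mul_comm E]
          exact mul_le_mul_of_nonneg_left (hEb t ht') (norm_nonneg _)
      _ = E * ∫ t in Sᶜ, ‖deltaW D (1 + t * I)‖ := integral_const_mul _ _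
      _ ≤ E * ∫ t : ℝ, ‖deltaW D (1 + t * I)‖ :=
          mul_le_mul_of_nonneg_left
            (setIntegral_le_integral hδint.norm (Eventually.of_forall fun t => norm_nonneg _)) hE
      _ ≤ E * (K * ell D ^ 5190) := mul_le_mul_of_nonneg_left (hK D hD3) hE
  -- absorbing the powers of `𝓛` in the tail term
  have hterm2 : |CT| * ell D ^ cT * (t0 D ^ (1.03 : ℝ)) ^ (A + 1 + 2) *
      ((D : ℝ) / 2) ^ (-((A + 1 : ℕ) : ℝ)) ≤ |CT| * (D : ℝ) ^ (-(A : ℝ)) := by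
    have hc : ell D ^ cT ≤ ell D ^ ⌈cT⌉₊ := by
      rw [← Real.rpow_natCast (ell D) ⌈cT⌉₊]
      exact Real.rpow_le_rpow_of_exponent_le hℓ1 (Nat.le_ceil cT)
    have hTpow : (t0 D ^ (1.03 : ℝ)) ^ (A + 1 + 2) ≤ ell D ^ (535 * (A + 1 + 2)) := by
      rw [pow_mul]; exact pow_le_pow_left₀ hT0nn hT535 (A + 1 + 2)
    have hmain : 2 ^ (A + 1) * (ell D ^ cT * (t0 D ^ (1.03 : ℝ)) ^ (A + 1 + 2)) ≤ (D : ℝ) := by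
      have h2 := hD₂ D (by omega)
      calc 2 ^ (A + 1) * (ell D ^ cT * (t0 D ^ (1.03 : ℝ)) ^ (A + 1 + 2))
          ≤ 2 ^ (A + 1) * (ell D ^ ⌈cT⌉₊ * ell D ^ (535 * (A + 1 + 2))) :=
            mul_le_mul_of_nonneg_left
              (mul_le_mul hc hTpow (pow_nonneg hT0nn _) (pow_nonneg hℓ0.le _)) (by positivity)
        _ = 2 ^ (A + 1) * ell D ^ (⌈cT⌉₊ + 535 * (A + 1 + 2)) := by rw [← pow_add]
        _ ≤ D := h2
    have e1 : ((D : ℝ) / 2) ^ (-((A + 1 : ℕ) : ℝ)) = 2 ^ (A + 1) / ((D : ℝ) * (D : ℝ) ^ A) := by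
      rw [Real.rpow_neg hX0.le, Real.rpow_natCast, div_pow, inv_div, pow_succ' (D : ℝ) A]
    have e2 : (D : ℝ) ^ (-(A : ℝ)) = ((D : ℝ) ^ A)⁻¹ := by rw [Real.rpow_neg hD0.le, Real.rpow_natCast]
    rw [e1, e2]
    have hDA : 0 < (D : ℝ) * (D : ℝ) ^ A := by positivity
    have hq : ell D ^ cT * (t0 D ^ (1.03 : ℝ)) ^ (A + 1 + 2) * (2 ^ (A + 1) / ((D : ℝ) * (D : ℝ) ^ A))
        ≤ ((D : ℝ) ^ A)⁻¹ := by
      rw [mul_div_assoc', div_le_iff₀ hDA]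
      calc ell D ^ cT * (t0 D ^ (1.03 : ℝ)) ^ (A + 1 + 2) * 2 ^ (A + 1)
          = 2 ^ (A + 1) * (ell D ^ cT * (t0 D ^ (1.03 : ℝ)) ^ (A + 1 + 2)) := by ring
        _ ≤ D := hmain
        _ = ((D : ℝ) ^ A)⁻¹ * ((D : ℝ) * (D : ℝ) ^ A) := by
            rw [mul_comm (D : ℝ) ((D : ℝ) ^ A), ← mul_assoc,
              inv_mul_cancel₀ (pow_ne_zero _ hD0.ne'), one_mul]
    calc |CT| * ell D ^ cT * (t0 D ^ (1.03 : ℝ)) ^ (A + 1 + 2) * (2 ^ (A + 1) / ((D : ℝ) * (D : ℝ) ^ A))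
        = |CT| * (ell D ^ cT * (t0 D ^ (1.03 : ℝ)) ^ (A + 1 + 2) *
            (2 ^ (A + 1) / ((D : ℝ) * (D : ℝ) ^ A))) := by ring
      _ ≤ |CT| * ((D : ℝ) ^ A)⁻¹ := mul_le_mul_of_nonneg_left hq (abs_nonneg _)
  -- assembling
  have hsplit : ∫ t : ℝ, f t = (∫ t in S, f t) + ∫ t in Sᶜ, f t := (integral_add_compl hSm hfi).symm
  have hDA0 : 0 ≤ (D : ℝ) ^ (-(A : ℝ)) := Real.rpow_nonneg hD0.le _
  have hℓK : 0 ≤ ell D ^ 5190 := pow_nonneg hℓ0.le _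
  have hI : ∫ t : ℝ, f t ≤ (K + |CT|) * (E * ell D ^ 5190 + F * (D : ℝ) ^ (-(A : ℝ))) := by
    rw [hsplit]
    have := add_le_add (hfS.trans (mul_le_mul_of_nonneg_left hterm2 hF)) hfSc
    nlinarith [mul_nonneg (mul_nonneg hE hℓK) (abs_nonneg CT), mul_nonneg (mul_nonneg hF hDA0) hK0]
  have h2π : 0 ≤ (1 / (2 * π) : ℝ) := by positivity
  calc ‖∑ p ∈ primeWindow D, a p * DeltaW D (c₀ / p)‖
      ≤ c₀⁻¹ * (1 / (2 * π)) * ∫ t : ℝ, f t := h1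
    _ ≤ c₀⁻¹ * (1 / (2 * π)) * ((K + |CT|) * (E * ell D ^ 5190 + F * (D : ℝ) ^ (-(A : ℝ)))) :=
        mul_le_mul_of_nonneg_left hI (mul_nonneg (inv_nonneg.mpr hc₀.le) h2π)
    _ = (1 / (2 * π)) * (K + |CT|) * c₀⁻¹ * (E * ell D ^ 5190 + F * (D : ℝ) ^ (-(A : ℝ))) := by ring

end Literature.NumberTheory.LFunctions.Zhang2022.Skeleton
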